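import Summits.Ventures.PercRepro.RankLevelSetE

/-!
# PercRepro — C-025 «RANK LEVEL-SET INEQUALITY»: Theorem F, the single-element induction step (p3, gen 6)

Mine-2's Theorem F (`proofs/MINE2-RLS.md` §6, §15; (N6) of the Theorem N decomposition): for a non-loop `e`,
with `N = M ＼ {e}` and `M ／ {e}`,
`(6.1)  #Y_M(p+1, q+1) = #Y_{M∖e}(p+1, q+1) + #Y_{M/e}(p, q)` and
`(6.2)  #U_M(p+1, q+1) = #U_{M∖e}(p+1, q+1) + #U_{M/e}(p, q) + D_e`, where `D_e` vanishes whenever no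
`A ⊆ E ∖ {e}` leaves `e` unspanned by both `A` and `(E ∖ {e}) ∖ A` — e.g. when `e` has a parallel partner.
This file proves the two inequalities the induction needs and the step itself:

* `delete_singleton_eRk_eq`, `contract_singleton_eRk_add_one` — ranks in `M ＼ {e}` and `M ／ {e}`
  (`r_{M/e}(X) + 1 = r_M(X ∪ {e})` through a basis containing `e`);
* `ncard_Y_delete_add_ncard_Y_contract_le` — (6.1) as `≥`: `S ∌ e` keeps its rank, `S′ ∪ {e}` has rank
  `r_{M/e}(S′) + 1`;
* `ncard_U_le_ncard_U_delete_add_ncard_U_contract` — (6.2) as `≤` under the spanning hypothesis: `A ∌ e`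
  goes to `U_{M∖e}` if `e ∈ cl((E ∖ {e}) ∖ A)` and to `U_{M/e}` otherwise; `A ∋ e` goes to `U_{M/e}` if
  `e ∈ cl(E ∖ A)` and to `U_{M∖e}` otherwise — an injection (the two rules never collide);
* `phiK_succ_succ_le` — `Φ(p+1, q+1) ≤ Φ(p, q)` (Lemma E, or both sides `0`);
* **`c025_step_of_delete_contract`** — the `C025` body for `M` at `(p+1, q+1)` from the bodies for `M ＼ {e}`
  at `(p+1, q+1)` and `M ／ {e}` at `(p, q)` (`step_arith`);
* `spans_of_parallel` — a parallel partner makes `e` unexposed (the hypothesis of the step).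
Set-builders as in `C025`. Axioms: standard.
-/

open scoped Matroid

namespace PercRepro

open Set

variable {α : Type} {M : Matroid α}

/-- Rank in `M ＼ {e}` of a set avoiding `e`. -/
lemma delete_singleton_eRk_eq {e : α} {X : Set α} (hX : X ⊆ M.E \ {e}) :
    (M ＼ {e}).eRk X = M.eRk X := by
  rw [Matroid.delete_eq_restrict, Matroid.restrict_eRk_eq _ hX]


/-- Rank in `M ／ {e}` of a set avoiding `e`, for a non-loop `e`: `r_{M/e}(X) + 1 = r_M(X ∪ {e})`. -/
lemma contract_singleton_eRk_add_one {e : α} (he : M.Indep {e}) {X : Set α} (hX : X ⊆ M.E \ {e}) :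
    (M ／ {e}).eRk X + 1 = M.eRk (insert e X) := by
  have heE : e ∈ M.E := he.subset_ground (mem_singleton e)
  have heX : e ∉ X := fun h => (hX h).2 rfl
  have hXE : insert e X ⊆ M.E := insert_subset heE (hX.trans sdiff_subset)
  obtain ⟨I, hI, heI⟩ := he.subset_isBasis_of_subset (singleton_subset_iff.2 (mem_insert e X)) hXE
  have hI' := hI.contract_isBasis_sdiff_sdiff_of_subset heI
  rw [insert_sdiff_self_of_notMem heX] at hI'
  rw [← hI'.encard_eq_eRk, ← hI.encard_eq_eRk,
    encard_sdiff_singleton_add_one (heI (mem_singleton e))]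


/-- `r_M(X ∪ {e}) = r_M(X)` when `e ∈ cl(X)` (`X ⊆ E`). -/
lemma eRk_insert_eq_of_mem_closure {e : α} {X : Set α} (hX : X ⊆ M.E) (he : e ∈ M.closure X) :
    M.eRk (insert e X) = M.eRk X := by
  refine le_antisymm ?_ (M.eRk_mono (subset_insert e X))
  calc M.eRk (insert e X) ≤ M.eRk (M.closure X) :=
        M.eRk_mono (insert_subset he (M.subset_closure X hX))
    _ = M.eRk X := M.eRk_closure_eq X


/-- **Theorem F, (6.1) as an inequality** (mine-2, MINE2-RLS.md §6): for a non-loop `e`,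
`#Y_{M ＼ e}(p+1, q+1) + #Y_{M ／ e}(p, q) ≤ #Y_M(p+1, q+1)` (the two families `S ∌ e`, `S = S′ ∪ {e}`;
in fact equality holds). -/
lemma ncard_Y_delete_add_ncard_Y_contract_le [M.Finite] {e : α} (he : M.Indep {e}) (p q : ℕ) :
    {A : Set α | A ⊆ (M ＼ {e}).E ∧ ((q + 1 : ℕ) : ℕ∞) < (M ＼ {e}).eRk A ∧
        (M ＼ {e}).eRk A < ((p + 1 : ℕ) : ℕ∞)}.ncard +
      {A : Set α | A ⊆ (M ／ {e}).E ∧ (q : ℕ∞) < (M ／ {e}).eRk A ∧ (M ／ {e}).eRk A < (p : ℕ∞)}.ncard ≤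
      {A : Set α | A ⊆ M.E ∧ ((q + 1 : ℕ) : ℕ∞) < M.eRk A ∧ M.eRk A < ((p + 1 : ℕ) : ℕ∞)}.ncard := by
  have hEfin : M.E.Finite := M.set_finite M.E
  have heE : e ∈ M.E := he.subset_ground (mem_singleton e)
  set Y₁ := {A : Set α | A ⊆ (M ＼ {e}).E ∧ ((q + 1 : ℕ) : ℕ∞) < (M ＼ {e}).eRk A ∧
      (M ＼ {e}).eRk A < ((p + 1 : ℕ) : ℕ∞)} with hY₁
  set Y₂ := {A : Set α | A ⊆ (M ／ {e}).E ∧ (q : ℕ∞) < (M ／ {e}).eRk A ∧ (M ／ {e}).eRk A < (p : ℕ∞)}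
    with hY₂
  set Y := {A : Set α | A ⊆ M.E ∧ ((q + 1 : ℕ) : ℕ∞) < M.eRk A ∧ M.eRk A < ((p + 1 : ℕ) : ℕ∞)} with hY
  have hYfin : Y.Finite := hEfin.finite_subsets.subset (fun A hA => hA.1)
  have hY₁fin : Y₁.Finite := (hEfin.subset sdiff_subset).finite_subsets.subset (fun A hA => hA.1)
  have hY₂fin : Y₂.Finite := (hEfin.subset sdiff_subset).finite_subsets.subset (fun A hA => hA.1)
  have hinj : InjOn (fun S => insert e S) Y₂ := by
    intro S hS S' hS' hEq
    have h1 : e ∉ S := fun h => (hS.1 h).2 rfl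
    have h2 : e ∉ S' := fun h => (hS'.1 h).2 rfl
    simp only at hEq
    rw [← insert_sdiff_self_of_notMem h1, ← insert_sdiff_self_of_notMem h2, hEq]
  have hdisj : Disjoint Y₁ ((fun S => insert e S) '' Y₂) := by
    rw [disjoint_left]
    rintro S hS ⟨S', -, rfl⟩
    exact (hS.1 (mem_insert e S')).2 rfl
  have hsub : Y₁ ∪ (fun S => insert e S) '' Y₂ ⊆ Y := by
    rintro S (hS | ⟨S', hS', rfl⟩)
    · obtain ⟨hSE, hq, hp⟩ := hS
      rw [Matroid.delete_ground] at hSE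
      rw [delete_singleton_eRk_eq hSE] at hq hp
      exact ⟨hSE.trans sdiff_subset, hq, hp⟩
    · obtain ⟨hSE, hq, hp⟩ := hS'
      rw [Matroid.contract_ground] at hSE
      have hr := contract_singleton_eRk_add_one he hSE
      refine ⟨insert_subset heE (hSE.trans sdiff_subset), ?_, ?_⟩
      · rw [← hr]; push_cast; exact (ENat.add_lt_add_iff_right (by simp)).2 hq
      · rw [← hr]; push_cast; exact (ENat.add_lt_add_iff_right (by simp)).2 hp
  calc Y₁.ncard + Y₂.ncard = Y₁.ncard + ((fun S => insert e S) '' Y₂).ncard := by rw [hinj.ncard_image]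
    _ = (Y₁ ∪ (fun S => insert e S) '' Y₂).ncard := (ncard_union_eq hdisj hY₁fin (hY₂fin.image _)).symm
    _ ≤ Y.ncard := ncard_le_ncard hsub hYfin


/-- Cancel `+ 1` in `ℕ∞`: `x + 1 = ↑(n + 1) → x = ↑n`. -/
lemma eq_coe_of_add_one_eq {x : ℕ∞} {n : ℕ} (h : x + 1 = ((n + 1 : ℕ) : ℕ∞)) : x = (n : ℕ∞) := by
  have h' : x + 1 = (n : ℕ∞) + 1 := by rw [h]; push_cast; rfl
  exact ENat.add_left_injective_of_ne_top (by simp) h'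


/-- **Theorem F, (6.2) with `D_e = 0`** (mine-2 §6, §15): for a non-loop `e` such that every
`A ⊆ E ∖ {e}` spans `e` on at least one side (`e ∈ cl(A)` or `e ∈ cl((E ∖ {e}) ∖ A)`),
`#U_M(p+1, q+1) ≤ #U_{M ＼ e}(p+1, q+1) + #U_{M ／ e}(p, q)`: send `A ∌ e` to `A` (into `U_{M ＼ e}` if
`e ∈ cl(E ∖ A ∖ {e})`, else into `U_{M ／ e}`) and `A ∋ e` to `A ∖ {e}` (into `U_{M ／ e}` if `e ∈ cl(E ∖ A)`,
else into `U_{M ＼ e}`); the two rules never collide. -/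
lemma ncard_U_le_ncard_U_delete_add_ncard_U_contract [M.Finite] {e : α} (he : M.Indep {e})
    (hunsp : ∀ A ⊆ M.E \ {e}, e ∈ M.closure A ∨ e ∈ M.closure ((M.E \ {e}) \ A)) (p q : ℕ) :
    {A : Set α | A ⊆ M.E ∧ M.eRk A = ((p + 1 : ℕ) : ℕ∞) ∧ M.eRk (M.E \ A) = ((q + 1 : ℕ) : ℕ∞)}.ncard ≤
      {A : Set α | A ⊆ (M ＼ {e}).E ∧ (M ＼ {e}).eRk A = ((p + 1 : ℕ) : ℕ∞) ∧
        (M ＼ {e}).eRk ((M ＼ {e}).E \ A) = ((q + 1 : ℕ) : ℕ∞)}.ncard +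
      {A : Set α | A ⊆ (M ／ {e}).E ∧ (M ／ {e}).eRk A = (p : ℕ∞) ∧
        (M ／ {e}).eRk ((M ／ {e}).E \ A) = (q : ℕ∞)}.ncard := by
  classical
  have hEfin : M.E.Finite := M.set_finite M.E
  have heE : e ∈ M.E := he.subset_ground (mem_singleton e)
  set U₁ := {A : Set α | A ⊆ (M ＼ {e}).E ∧ (M ＼ {e}).eRk A = ((p + 1 : ℕ) : ℕ∞) ∧
      (M ＼ {e}).eRk ((M ＼ {e}).E \ A) = ((q + 1 : ℕ) : ℕ∞)} with hU₁
  set U₂ := {A : Set α | A ⊆ (M ／ {e}).E ∧ (M ／ {e}).eRk A = (p : ℕ∞) ∧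
      (M ／ {e}).eRk ((M ／ {e}).E \ A) = (q : ℕ∞)} with hU₂
  have hU₁fin : U₁.Finite := (hEfin.subset sdiff_subset).finite_subsets.subset (fun A hA => hA.1)
  have hU₂fin : U₂.Finite := (hEfin.subset sdiff_subset).finite_subsets.subset (fun A hA => hA.1)
  have hT : (Sum.inl '' U₁ ∪ Sum.inr '' U₂ : Set (Set α ⊕ Set α)).ncard = U₁.ncard + U₂.ncard := by
    rw [ncard_union_eq ?_ (hU₁fin.image _) (hU₂fin.image _),
      ncard_image_of_injective _ Sum.inl_injective, ncard_image_of_injective _ Sum.inr_injective]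
    rw [disjoint_left]
    rintro x ⟨a, -, rfl⟩ ⟨b, -, hb⟩
    exact Sum.inl_ne_inr hb.symm
  rw [← hT]
  -- the injection
  let f : Set α → Set α ⊕ Set α := fun A =>
    if e ∈ A then
      (if e ∈ M.closure ((M.E \ {e}) \ (A \ {e})) then Sum.inr (A \ {e}) else Sum.inl (A \ {e}))
    else (if e ∈ M.closure ((M.E \ {e}) \ A) then Sum.inl A else Sum.inr A)
  have hE' : (M ＼ {e}).E = M.E \ {e} := Matroid.delete_ground M {e}
  have hE'' : (M ／ {e}).E = M.E \ {e} := Matroid.contract_ground M {e}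
  refine ncard_le_ncard_of_injOn f ?_ ?_ ((hU₁fin.image _).union (hU₂fin.image _))
  · rintro A ⟨hA, hpA, hqA⟩
    by_cases heA : e ∈ A
    · -- `A = insert e A′`
      have hA'E : A \ {e} ⊆ M.E \ {e} := sdiff_subset_sdiff_left hA
      have hAeq : insert e (A \ {e}) = A := by rw [insert_sdiff_singleton, insert_eq_of_mem heA]
      have hcompl : M.E \ A = (M.E \ {e}) \ (A \ {e}) := by
        ext x
        simp only [mem_sdiff, mem_singleton_iff]
        constructor
        · rintro ⟨hxE, hxA⟩
          exact ⟨⟨hxE, fun hxe => hxA (hxe ▸ heA)⟩, fun h => hxA h.1⟩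
        · rintro ⟨⟨hxE, hxe⟩, h⟩
          exact ⟨hxE, fun hxA => h ⟨hxA, hxe⟩⟩
      by_cases hcl : e ∈ M.closure ((M.E \ {e}) \ (A \ {e}))
      · simp only [f, heA, hcl, if_true]
        refine Or.inr ⟨A \ {e}, ⟨?_, ?_, ?_⟩, rfl⟩
        · rw [hE'']; exact hA'E
        · apply eq_coe_of_add_one_eq
          rw [contract_singleton_eRk_add_one he hA'E, hAeq, hpA]
        · apply eq_coe_of_add_one_eq
          rw [hE'', contract_singleton_eRk_add_one he sdiff_subset,
            eRk_insert_eq_of_mem_closure (sdiff_subset.trans sdiff_subset) hcl, ← hcompl, hqA]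
      · simp only [f, heA, hcl, if_true, if_false]
        have hclA : e ∈ M.closure (A \ {e}) := (hunsp _ hA'E).resolve_right hcl
        refine Or.inl ⟨A \ {e}, ⟨?_, ?_, ?_⟩, rfl⟩
        · rw [hE']; exact hA'E
        · rw [delete_singleton_eRk_eq hA'E, ← eRk_insert_eq_of_mem_closure (hA'E.trans sdiff_subset) hclA,
            hAeq, hpA]
        · rw [hE', delete_singleton_eRk_eq sdiff_subset, ← hcompl, hqA]
    · -- `A ∌ e`
      have hAE : A ⊆ M.E \ {e} := fun x hx => ⟨hA hx, fun hxe => heA (hxe ▸ hx)⟩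
      have hcompl : M.E \ A = insert e ((M.E \ {e}) \ A) := by
        ext x
        simp only [mem_sdiff, mem_singleton_iff, mem_insert_iff]
        constructor
        · rintro ⟨hxE, hxA⟩
          by_cases hxe : x = e
          · exact Or.inl hxe
          · exact Or.inr ⟨⟨hxE, hxe⟩, hxA⟩
        · rintro (rfl | ⟨⟨hxE, -⟩, hxA⟩)
          · exact ⟨heE, heA⟩
          · exact ⟨hxE, hxA⟩
      by_cases hcl : e ∈ M.closure ((M.E \ {e}) \ A)
      · simp only [f, heA, hcl, if_true, if_false]
        refine Or.inl ⟨A, ⟨?_, ?_, ?_⟩, rfl⟩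
        · rw [hE']; exact hAE
        · rw [delete_singleton_eRk_eq hAE, hpA]
        · rw [hE', delete_singleton_eRk_eq sdiff_subset,
            ← eRk_insert_eq_of_mem_closure (sdiff_subset.trans sdiff_subset) hcl, ← hcompl, hqA]
      · simp only [f, heA, hcl, if_false]
        have hclA : e ∈ M.closure A := (hunsp _ hAE).resolve_right hcl
        refine Or.inr ⟨A, ⟨?_, ?_, ?_⟩, rfl⟩
        · rw [hE'']; exact hAE
        · apply eq_coe_of_add_one_eq
          rw [contract_singleton_eRk_add_one he hAE,
            eRk_insert_eq_of_mem_closure (hAE.trans sdiff_subset) hclA, hpA]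
        · apply eq_coe_of_add_one_eq
          rw [hE'', contract_singleton_eRk_add_one he sdiff_subset, ← hcompl, hqA]
  · -- injectivity
    rintro A ⟨hA, -, -⟩ B ⟨hB, -, -⟩ hEq
    simp only [f] at hEq
    have key : ∀ {X Y : Set α}, X \ {e} = Y →
        ((M.E \ {e}) \ (X \ {e})) = ((M.E \ {e}) \ Y) := fun h => by rw [h]
    have hrec : ∀ {X Y : Set α}, e ∈ X → e ∈ Y → X \ {e} = Y \ {e} → X = Y := by
      intro X Y hX hY h
      rw [← insert_eq_of_mem hX, ← insert_sdiff_singleton, h, insert_sdiff_singleton,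
        insert_eq_of_mem hY]
    by_cases heA : e ∈ A <;> by_cases heB : e ∈ B
    · by_cases h1 : e ∈ M.closure ((M.E \ {e}) \ (A \ {e})) <;>
        by_cases h2 : e ∈ M.closure ((M.E \ {e}) \ (B \ {e})) <;>
        simp only [heA, heB, h1, h2, if_true, if_false, Sum.inr.injEq, Sum.inl.injEq,
          reduceCtorEq] at hEq <;>
        exact hrec heA heB hEq
    · by_cases h1 : e ∈ M.closure ((M.E \ {e}) \ (A \ {e})) <;>
        by_cases h2 : e ∈ M.closure ((M.E \ {e}) \ B) <;>
        simp only [heA, heB, h1, h2, if_true, if_false, Sum.inr.injEq, Sum.inl.injEq,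
          reduceCtorEq] at hEq
      · exact absurd (key hEq ▸ h1) h2
      · exact absurd (key hEq ▸ h2) h1
    · by_cases h1 : e ∈ M.closure ((M.E \ {e}) \ A) <;>
        by_cases h2 : e ∈ M.closure ((M.E \ {e}) \ (B \ {e})) <;>
        simp only [heA, heB, h1, h2, if_true, if_false, Sum.inr.injEq, Sum.inl.injEq,
          reduceCtorEq] at hEq
      · exact absurd (key hEq.symm ▸ h1) h2
      · exact absurd (key hEq.symm ▸ h2) h1
    · by_cases h1 : e ∈ M.closure ((M.E \ {e}) \ A) <;>
        by_cases h2 : e ∈ M.closure ((M.E \ {e}) \ B) <;>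
        simp only [heA, heB, h1, h2, if_true, if_false, Sum.inr.injEq, Sum.inl.injEq,
          reduceCtorEq] at hEq <;>
        exact hEq


/-- `Φ(p+1, q+1) ≤ Φ(p, q)` for all `p, q` (Lemma E, or both sides `0`). -/
lemma phiK_succ_succ_le (p q : ℕ) : phiK (p + 1) (q + 1) ≤ phiK p q := by
  by_cases h : q + 2 ≤ p
  · exact le_of_lt (phiK_succ_succ_lt h)
  · have h0 : phiK (p + 1) (q + 1) = 0 := by
      unfold phiK
      rw [Finset.sum_eq_zero (fun u hu => by rw [Finset.mem_Ioo] at hu; omega), zero_div]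
    rw [h0]
    unfold phiK
    positivity


/-- The arithmetic of the induction step: from `u ≤ u₁ + u₂`, `y₁ + y₂ ≤ y`, `a·u₁ ≤ y₁`, `b·u₂ ≤ y₂` and
`0 ≤ a ≤ b`, conclude `a·u ≤ y`. -/
lemma step_arith {a b : ℚ} {u u₁ u₂ y y₁ y₂ : ℕ} (ha : 0 ≤ a) (hab : a ≤ b) (hU : u ≤ u₁ + u₂)
    (hY : y₁ + y₂ ≤ y) (h1 : a * (u₁ : ℚ) ≤ y₁) (h2 : b * (u₂ : ℚ) ≤ y₂) : a * (u : ℚ) ≤ y := by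
  have hU' : (u : ℚ) ≤ u₁ + u₂ := by exact_mod_cast hU
  have hY' : (y₁ : ℚ) + y₂ ≤ y := by exact_mod_cast hY
  have hu₂nn : (0 : ℚ) ≤ u₂ := by positivity
  have h3 : a * (u₂ : ℚ) ≤ b * (u₂ : ℚ) := mul_le_mul_of_nonneg_right hab hu₂nn
  have h4 : a * (u : ℚ) ≤ a * (u₁ : ℚ) + a * (u₂ : ℚ) := by
    rw [← mul_add]
    exact mul_le_mul_of_nonneg_left hU' ha
  linarith

/-- **The single-element induction step of C-025** (mine-2, MINE2-RLS.md §6 (6.3) with `D_e ≤ 0`, §15): for a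
non-loop `e` such that every `A ⊆ E ∖ {e}` spans `e` on at least one side, the `C025` body for `M` at
`(p+1, q+1)` follows from the `C025` body for `M ＼ {e}` at `(p+1, q+1)` and for `M ／ {e}` at `(p, q)`
(through (6.1), (6.2) and Lemma E). -/
theorem c025_step_of_delete_contract [M.Finite] {e : α} (he : M.Indep {e})
    (hunsp : ∀ A ⊆ M.E \ {e}, e ∈ M.closure A ∨ e ∈ M.closure ((M.E \ {e}) \ A)) (p q : ℕ)
    (h1 : phiK (p + 1) (q + 1) *
        ({A : Set α | A ⊆ (M ＼ {e}).E ∧ (M ＼ {e}).eRk A = ((p + 1 : ℕ) : ℕ∞) ∧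
          (M ＼ {e}).eRk ((M ＼ {e}).E \ A) = ((q + 1 : ℕ) : ℕ∞)}.ncard : ℚ) ≤
        ({A : Set α | A ⊆ (M ＼ {e}).E ∧ ((q + 1 : ℕ) : ℕ∞) < (M ＼ {e}).eRk A ∧
          (M ＼ {e}).eRk A < ((p + 1 : ℕ) : ℕ∞)}.ncard : ℚ))
    (h2 : phiK p q *
        ({A : Set α | A ⊆ (M ／ {e}).E ∧ (M ／ {e}).eRk A = (p : ℕ∞) ∧
          (M ／ {e}).eRk ((M ／ {e}).E \ A) = (q : ℕ∞)}.ncard : ℚ) ≤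
        ({A : Set α | A ⊆ (M ／ {e}).E ∧ (q : ℕ∞) < (M ／ {e}).eRk A ∧
          (M ／ {e}).eRk A < (p : ℕ∞)}.ncard : ℚ)) :
    phiK (p + 1) (q + 1) *
      ({A : Set α | A ⊆ M.E ∧ M.eRk A = ((p + 1 : ℕ) : ℕ∞) ∧
        M.eRk (M.E \ A) = ((q + 1 : ℕ) : ℕ∞)}.ncard : ℚ) ≤
      ({A : Set α | A ⊆ M.E ∧ ((q + 1 : ℕ) : ℕ∞) < M.eRk A ∧ M.eRk A < ((p + 1 : ℕ) : ℕ∞)}.ncard : ℚ) := by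
  exact step_arith hnn_phi (phiK_succ_succ_le p q)
    (ncard_U_le_ncard_U_delete_add_ncard_U_contract he hunsp p q)
    (ncard_Y_delete_add_ncard_Y_contract_le he p q) h1 h2
where
  hnn_phi : 0 ≤ phiK (p + 1) (q + 1) := by
    unfold phiK
    positivity

/-- An element with a parallel partner is «unexposed» (mine-2 §15): every `A ⊆ E ∖ {e}` spans `e` on the
side containing `e′`. -/
lemma spans_of_parallel {e e' : α} (he' : e' ∈ M.E) (hne : e' ≠ e) (hpar : e ∈ M.closure {e'}) :
    ∀ A ⊆ M.E \ {e}, e ∈ M.closure A ∨ e ∈ M.closure ((M.E \ {e}) \ A) := by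
  intro A hA
  by_cases h : e' ∈ A
  · exact Or.inl (M.closure_subset_closure (singleton_subset_iff.2 h) hpar)
  · exact Or.inr (M.closure_subset_closure
      (singleton_subset_iff.2 (show e' ∈ (M.E \ {e}) \ A from ⟨⟨he', hne⟩, h⟩)) hpar)

end PercRepro
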